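import Summits.MatrixMultiplication.MatrixMultiplication.Theorems.AbelianSTPPCensusFP2Defs

/-!
# Rule U11-F2: soundness of the kernel checker `FP2.check`

Cell mm-stpp (rung F-M1), PRE-REG v1 band B3 (seat mm-stpp-theory, gen 13).  `FP2.check p X Y Z va vb vc lo n = true`
(`AbelianSTPPCensusFP2Defs.lean`) implies that NO triple of coset counts `(x, y, z)` with `lo ≤ x < lo + n` passes the three letter
forms `FormOK p X Y Z vb x y z ∧ FormOK p Z X Y va z x y ∧ FormOK p Y Z X vc y z x` of `FP2Adm` (`FP2.check_sound`).  Ingredients: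
the menu parameters are admissible (`param_le_left/right`); a Boolean violation refutes `CosetIneq` (`not_cosetIneq_of_violAt`,
`not_cosetIneq_of_cosetKilled`); the THRESHOLD lemma `not_cosetIneq_of_thrAt_le`: with `T = s₀ + s₁ > v`, floor `Fl ≤ T·p`, every target
count `W` with `(T·p − Fl)/(T − v) + 1 ≤ W ≤ p` violates `Fl ≤ W·v + T·(p − W)` (`thr_arith`), so `thr ≤ W ≤ p` refutes the coset
(`not_cosetIneq_of_thr_le`, via `foldr_min_le`); hence at a cell `(x, y)` a surviving `z` lies in `[Z − (t₁ − 1), min(t₀ − 1, Z)]`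
(`t₀`, `t₁` the form-B thresholds of the cosets `P`, `P′`), where `cellOK` tests `tripleKilled` (`cellOK_sound`).
(Appended, same seat:) `not_fp2Adm_of_checks` — the entry point for any shape list at `M = 2p`: range checks covering `x ≤ P_AB` ⇒ `¬ FP2Adm M`.
Seat scratch of record `work/FP2CheckScratch.lean`.  WHAT THIS IS NOT: no statement about STPP families (that is `…FP2Sound.lean`) and no
evaluation (that is `…FP2Wall478.lean`); arithmetic on the checker only.
-/

set_option linter.dupNamespace false -- `MatrixMultiplication.MatrixMultiplication` (summit = problem, D-0017)
set_option autoImplicit false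

namespace Summit.MatrixMultiplication.MatrixMultiplication.Theorems

open Finset

namespace FP2

/-! ### Soundness of the checker -/

section CheckSound

variable {p : ℕ}

/-- The menu parameter is admissible (first class). [bookkeeping] -/
theorem param_le_left (p f g k : ℕ) : param p f g k ≤ f := (min_le_left _ _).trans (min_le_left _ _)

/-- The menu parameter is admissible (second class). [bookkeeping] -/
theorem param_le_right (p f g k : ℕ) : param p f g k ≤ g := (min_le_left _ _).trans (min_le_right _ _)

/-- A violation at admissible parameters refutes the coset inequality. [bookkeeping] -/
theorem not_cosetIneq_of_violAt {f₀ g₀ f₁ g₁ W v s₀ s₁ : ℕ} (h0f : s₀ ≤ f₀) (h0g : s₀ ≤ g₀) (h1f : s₁ ≤ f₁) (h1g : s₁ ≤ g₁)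
    (hv : violAt p f₀ g₀ f₁ g₁ W v s₀ s₁ = true) : ¬ CosetIneq p f₀ g₀ f₁ g₁ W v := by
  intro hc
  have := hc s₀ s₁ h0f h0g h1f h1g
  unfold violAt ceil at hv
  rw [decide_eq_true_eq] at hv
  omega

/-- A menu violation refutes the coset inequality. [bookkeeping] -/
theorem not_cosetIneq_of_cosetKilled {f₀ g₀ f₁ g₁ W v : ℕ} (h : cosetKilled p f₀ g₀ f₁ g₁ W v = true) :
    ¬ CosetIneq p f₀ g₀ f₁ g₁ W v := by
  unfold cosetKilled at h
  simp only [List.any_eq_true] at h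
  obtain ⟨k₀, -, k₁, -, hv⟩ := h
  exact not_cosetIneq_of_violAt (param_le_left _ _ _ _) (param_le_right _ _ _ _) (param_le_left _ _ _ _)
    (param_le_right _ _ _ _) hv

/-- The floor of a coset is at most `T · p`. [bookkeeping] -/
theorem pairFloor_add_le (p f₀ g₀ f₁ g₁ s₀ s₁ : ℕ) :
    pairFloor p f₀ g₀ s₀ + pairFloor p f₁ g₁ s₁ ≤ (s₀ + s₁) * p := by
  unfold pairFloor
  have h0 : s₀ * min p (f₀ + g₀ - s₀) ≤ s₀ * p := Nat.mul_le_mul_left _ (min_le_left _ _)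
  have h1 : s₁ * min p (f₁ + g₁ - s₁) ≤ s₁ * p := Nat.mul_le_mul_left _ (min_le_left _ _)
  rw [Nat.add_mul]; exact Nat.add_le_add h0 h1

/-- Threshold arithmetic: `v < T`, `Fl ≤ T p`, `W ≤ p` and `(T p − Fl)/(T − v) + 1 ≤ W` contradict `Fl ≤ W v + T (p − W)`. [bookkeeping] -/
theorem thr_arith {T Fl W v p : ℕ} (hT : v < T) (hFl : Fl ≤ T * p) (hWp : W ≤ p)
    (hW : (T * p - Fl) / (T - v) + 1 ≤ W) (hle : Fl ≤ W * v + T * (p - W)) : False := by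
  have h1 : (T * p - Fl) / (T - v) < W := Nat.lt_of_succ_le hW
  have h2 : T * p - Fl < W * (T - v) := (Nat.div_lt_iff_lt_mul (by omega)).mp h1
  obtain ⟨d, rfl⟩ := Nat.exists_eq_add_of_le hWp
  obtain ⟨e, rfl⟩ := Nat.exists_eq_add_of_lt hT
  simp only [Nat.add_sub_cancel_left, show v + e + 1 - v = e + 1 by omega] at h2 hle
  have h3 : (v + e + 1) * (W + d) < W * (e + 1) + Fl := by omega
  nlinarith [h3, hle]

/-- A target count between a parameter threshold and `p` refutes the coset inequality. [bookkeeping] -/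
theorem not_cosetIneq_of_thrAt_le {f₀ g₀ f₁ g₁ W v s₀ s₁ : ℕ} (h0f : s₀ ≤ f₀) (h0g : s₀ ≤ g₀) (h1f : s₁ ≤ f₁)
    (h1g : s₁ ≤ g₁) (hW : thrAt p f₀ g₀ f₁ g₁ v s₀ s₁ ≤ W) (hWp : W ≤ p) : ¬ CosetIneq p f₀ g₀ f₁ g₁ W v := by
  intro hc
  have hle := hc s₀ s₁ h0f h0g h1f h1g
  unfold thrAt at hW
  split_ifs at hW with hT
  · rw [min_eq_right (le_of_lt hT)] at hle
    exact thr_arith hT (pairFloor_add_le p f₀ g₀ f₁ g₁ s₀ s₁) hWp hW hle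
  · omega

/-- A right fold of `min` below `W` has its seed or a member below `W`. [bookkeeping] -/
theorem foldr_min_le {L : List ℕ} {init W : ℕ} (h : L.foldr min init ≤ W) : init ≤ W ∨ ∃ x ∈ L, x ≤ W := by
  induction L with
  | nil => exact Or.inl h
  | cons a L ih =>
    rw [List.foldr_cons] at h
    rcases min_le_iff.mp h with ha | hL
    · exact Or.inr ⟨a, List.mem_cons_self, ha⟩
    · rcases ih hL with hi | ⟨x, hx, hxW⟩
      · exact Or.inl hi
      · exact Or.inr ⟨x, List.mem_cons_of_mem a hx, hxW⟩

/-- A target count between the menu threshold and `p` refutes the coset inequality. [bookkeeping] -/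
theorem not_cosetIneq_of_thr_le {f₀ g₀ f₁ g₁ W v : ℕ} (hW : thr p f₀ g₀ f₁ g₁ v ≤ W) (hWp : W ≤ p) :
    ¬ CosetIneq p f₀ g₀ f₁ g₁ W v := by
  unfold thr at hW
  rcases foldr_min_le hW with h | ⟨x, hx, hxW⟩
  · omega
  · rw [List.mem_flatMap] at hx
    obtain ⟨k₀, -, hx⟩ := hx
    rw [List.mem_map] at hx
    obtain ⟨k₁, -, rfl⟩ := hx
    exact not_cosetIneq_of_thrAt_le (param_le_left _ _ _ _) (param_le_right _ _ _ _) (param_le_left _ _ _ _)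
      (param_le_right _ _ _ _) hxW hWp

/-- `formKilled = true` refutes `FormOK`. [bookkeeping] -/
theorem not_formOK_of_formKilled {F S Wt v f s w : ℕ} (h : formKilled p F S Wt v f s w = true) :
    ¬ FormOK p F S Wt v f s w := by
  rintro ⟨h1, h2, h3, h4, h5, h6, h7, h8, h9⟩
  unfold formKilled at h
  simp only [Bool.or_eq_true, decide_eq_true_eq] at h
  rcases h with (((((((h | h) | h) | h) | h) | h) | h) | h) | h
  · omega
  · omega
  · omega
  · omega
  · omega
  · exact not_cosetIneq_of_cosetKilled h h6
  · exact not_cosetIneq_of_cosetKilled h h7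
  · omega
  · omega

/-- `tripleKilled = true` refutes the conjunction of the three letter forms. [bookkeeping] -/
theorem not_forms_of_tripleKilled {X Y Z va vb vc x y z : ℕ} (h : tripleKilled p X Y Z va vb vc x y z = true) :
    ¬ (FormOK p X Y Z vb x y z ∧ FormOK p Z X Y va z x y ∧ FormOK p Y Z X vc y z x) := by
  rintro ⟨hB, hA, hC⟩
  unfold tripleKilled at h
  simp only [Bool.or_eq_true] at h
  rcases h with (h | h) | h
  · exact not_formOK_of_formKilled h hB
  · exact not_formOK_of_formKilled h hA
  · exact not_formOK_of_formKilled h hC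

/-- `cellOK = true` refutes every `z` at the cell `(x, y)`. [bookkeeping] -/
theorem cellOK_sound {X Y Z va vb vc x y : ℕ} (h : cellOK p X Y Z va vb vc x y = true) (z : ℕ) :
    ¬ (FormOK p X Y Z vb x y z ∧ FormOK p Z X Y va z x y ∧ FormOK p Y Z X vc y z x) := by
  rintro ⟨hB, hA, hC⟩
  obtain ⟨-, -, hzZ, hzp, hz1p, hc0, hc1, -, -⟩ := id hB
  unfold cellOK at h
  simp only [List.all_eq_true] at h
  by_cases hlo : Z - (thr p x (Y - y) (X - x) y vb - 1) ≤ z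
  · by_cases hhi : z ≤ min (thr p x y (X - x) (Y - y) vb - 1) Z
    · have hz : z ∈ List.range' (Z - (thr p x (Y - y) (X - x) y vb - 1))
          (min (thr p x y (X - x) (Y - y) vb - 1) Z + 1 - (Z - (thr p x (Y - y) (X - x) y vb - 1))) := by
        rw [List.mem_range'_1]; omega
      exact not_forms_of_tripleKilled (h z hz) ⟨hB, hA, hC⟩
    · exact not_cosetIneq_of_thr_le (by omega) hzp hc0
  · exact not_cosetIneq_of_thr_le (by omega) hz1p hc1

/-- **Soundness of the checker.**  If `check p X Y Z va vb vc lo n = true` then no `(x, y, z)` with `lo ≤ x < lo + n` passes the three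
letter forms. [original] -/
theorem check_sound {X Y Z va vb vc lo n : ℕ} (h : check p X Y Z va vb vc lo n = true) {x y z : ℕ} (hx : lo ≤ x)
    (hx' : x < lo + n) : ¬ (FormOK p X Y Z vb x y z ∧ FormOK p Z X Y va z x y ∧ FormOK p Y Z X vc y z x) := by
  intro hh
  have hy : y ≤ Y := hh.1.2.1
  unfold check at h
  simp only [List.all_eq_true] at h
  exact cellOK_sound (h x (List.mem_range'_1.mpr ⟨hx, hx'⟩) y (List.mem_range.mpr (Nat.lt_succ_of_le hy))) z hh


/-- **Using the checker on any shape list.**  If `M = 2p` with `p` prime and the checker passes on `x`-ranges covering `0 … P_AB`, the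
list is not `FP2Adm M` (the device seat's entry point: one `decide +kernel` per range plus a `decide` for the cover). [original] -/
theorem not_fp2Adm_of_checks {N M : ℕ} (hM : M = 2 * p) (hp : p.Prime) {a b c : Fin N → ℕ} (ranges : List (ℕ × ℕ))
    (hchk : (ranges.all fun r => check p (pAB a b c) (pBC a b c) (pCA a b c) (univ.sup a) (univ.sup b) (univ.sup c) r.1 r.2) = true)
    (hcover : ∀ x, x ≤ pAB a b c → ∃ r ∈ ranges, r.1 ≤ x ∧ x < r.1 + r.2) : ¬ FP2Adm M a b c := by
  intro h
  obtain ⟨x, y, z, hB, hA, hC⟩ := h p hM hp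
  obtain ⟨r, hr, hx, hx'⟩ := hcover x hB.1
  rw [List.all_eq_true] at hchk
  exact check_sound (hchk r hr) hx hx' ⟨hB, hA, hC⟩

end CheckSound

end FP2

end Summit.MatrixMultiplication.MatrixMultiplication.Theorems
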